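import Summits.QuantumFields.YangMills.Theorems.UnitScaleTiltFluctuationComparisonRegPrPolymerEstimate
import Summits.QuantumFields.YangMills.Theorems.UnitScaleTiltFluctuationComparisonRegPrPolymerBudget
import Summits.QuantumFields.YangMills.Theorems.UnitScaleTiltFluctuationComparisonRegPrSocketPolymers
import Literature.MathematicalPhysics.QuantumFieldTheory.Balaban1983to89.T3AlphaInputsACSchemas
import HarnessLib

/-!
# Route `UnitScaleTilt` — crux K1bR-pr `FluctuationComparisonRegPr` (stmt-QuantumFields-19201), S-E″ bookkeeping, part 3: THE CUT-OFF-CAUCHY PROPERTY OF THE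
# INTERACTION DATA FROM THE PER-RUN CLAUSES, THE CORRECTED TWO-RUN BUNDLE AND THE MINIMISER CLOSENESS — threshold-free
# (support file `--supports stmt-QuantumFields-19201`)

Fleet lead `ym-ust-19201-p2` (gen 2, socket pen); FINDING-19201-SE2-scaling (evidence #53 on the item).  The S-E″ rung of the ladder of record, CLOSED:
`CauchyAtHeights D b₀ p₀ m ⇐(p456396) LevelCauchyAt (levelData D) ⇐(p458947) LocMatched D ∧ PolymerCauchyAt D b₀ p₀ m ⇐(THIS FILE) PintDecomp ∧ AdmOnSmall ∧
UminTrivIsRegMinimiser ∧ TrivRegions ∧ Regularity68 ∧ TwoRunLv D b₀ p₀ C68 a ∧ MinimiserCauchyAt F γ ε₀ b₀ p₀ a₁` for EVERY `m > (3+b)/b`, `b = min(a, a₁, 1)`,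
at EVERY `0 < γ ≤ 1`, `0 < b₀`, `0 < p₀`, `1 < L` — NO `ε₁`/`γ₁` threshold: the three guards of the per-polymer estimate (part 1) read `B·θ(⌊K/m⌋) ≤ σ` and hold
for `K ≥ K₀(D)` (`T3Thresholds.eventually_mul_θBal_div_le`); the finitely many `K < K₀` take the size fallback `|𝒫′| + |𝒫| + |c|` (TermSize), which costs
summability nothing; the extra finest slice is bounded by TermSize alone (part 2).  `polymerCauchyAt_of_twoRunLv` builds the witnesses of the socket
`T3AlphaPolymerSocket.PolymerCauchyAt`; `cauchyAtHeights_of_twoRunLv` composes with p458947/p456396; `levelCauchyOfSchemas_lv` is the same in the quantifier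
shape of the registered v5d stub `stub_levelCauchyOfSchemas` with `TwoRun ↦ TrivRegions ∧ TwoRunLv` (the registered text consumes the mis-scaled
`PolymerCauchyBgAt` and lacks `TrivRegions`, see the finding) — the PROPOSED v5e text.  WHAT THIS IS NOT: no estimate of Bałaban's or King's is asserted; every
analytic input is a hypothesis schema.

References: C. King, CMP 102 (1986) 649–677 [King1986] (Thm 3.4 (3.9) p.656, (3.12)–(3.13) p.657, Prop. 3.9 p.665, p.675); T. Bałaban, CMP 102 (1985)
255–275 [Balaban1985UV3] ((43)–(46) pp.266–267, (68) p.273).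
-/

noncomputable section

open MeasureTheory Filter Topology
open Literature.MathematicalPhysics.QuantumFieldTheory.Balaban1983to89
open Literature.MathematicalPhysics.QuantumFieldTheory.Balaban1983to89.T3ContinuumYM3Torus
open Literature.MathematicalPhysics.QuantumFieldTheory.Balaban1983to89.T3LevelShift
open Literature.MathematicalPhysics.QuantumFieldTheory.Balaban1983to89.T3UnitLawDensityEML (ℰp measurableE_ℰp)
open Literature.MathematicalPhysics.QuantumFieldTheory.Balaban1983to89.T3UnitScaleTilt
open Literature.MathematicalPhysics.QuantumFieldTheory.Balaban1983to89.T3TiltDescent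
open Literature.MathematicalPhysics.QuantumFieldTheory.Balaban1983to89.T3PrintedRegularMinimiser
open Literature.MathematicalPhysics.QuantumFieldTheory.Balaban1983to89.T3LogComparisonSocket
open Literature.MathematicalPhysics.QuantumFieldTheory.Balaban1983to89.T3AlphaInputsAC
open Literature.MathematicalPhysics.QuantumFieldTheory.Balaban1983to89.T3AlphaPolymerSocket
open Literature.MathematicalPhysics.QuantumFieldTheory.Balaban1983to89.T3AlphaInputsACTwoRun
open Literature.MathematicalPhysics.QuantumFieldTheory.Balaban1983to89.T3AlphaInputsACTwoRunLevel
open Literature.MathematicalPhysics.QuantumFieldTheory.Balaban1983to89.ExpMeanLog (deltaSU deltaSU_pos)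
open Literature.MathematicalPhysics.QuantumFieldTheory.Balaban1983to89.Missing
open Summit.QuantumFields.YangMills.Theorems.LogComparisonPolymerEstimate (abs_matched_sub_le abs_pterm_umin_triv_le)
open Summit.QuantumFields.YangMills.Theorems.LogComparisonPolymerBudget

namespace Summit.QuantumFields.YangMills.Theorems.LogComparisonLevelCauchy

variable {F : T3Family} {γ : ℝ} (D : AlphaDataT3 F γ)

/-! ## §1 Arithmetic of the good regime: the two pieces of the per-polymer estimate under one monomial -/

/-- In the good regime the per-polymer bound `C⁺Eθ²x₄xᵃ + Q·θ³E·x₄·x^{a₁}` is at most `(C⁺Θ² + QΘ³)·E·x₄·xᵇ` for `0 < θ ≤ Θ`, `0 < x ≤ 1`, `b ≤ a`, `b ≤ a₁`,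
`0 ≤ Q`, `0 ≤ E`, `0 ≤ x₄` (bookkeeping). [folklore] -/
theorem good_bound {Cp Q θ Θ E x₄ x a a₁ b : ℝ} (hQ : 0 ≤ Q) (hθ : 0 < θ) (hθΘ : θ ≤ Θ) (hE : 0 ≤ E) (hx₄ : 0 ≤ x₄)
    (hx0 : 0 < x) (hx1 : x ≤ 1) (hba : b ≤ a) (hba₁ : b ≤ a₁) :
    max Cp 0 * E * θ ^ 2 * x₄ * x ^ a + Q * θ ^ 3 * E * x₄ * x ^ a₁ ≤ (max Cp 0 * Θ ^ 2 + Q * Θ ^ 3) * E * x₄ * x ^ b := by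
  have hxa : x ^ a ≤ x ^ b := Real.rpow_le_rpow_of_exponent_ge hx0 hx1 hba
  have hxa₁ : x ^ a₁ ≤ x ^ b := Real.rpow_le_rpow_of_exponent_ge hx0 hx1 hba₁
  have hθ2 : θ ^ 2 ≤ Θ ^ 2 := pow_le_pow_left₀ hθ.le hθΘ 2
  have hθ3 : θ ^ 3 ≤ Θ ^ 3 := pow_le_pow_left₀ hθ.le hθΘ 3
  have hΘ : 0 ≤ Θ := hθ.le.trans hθΘ
  have h1 : θ ^ 2 * x ^ a ≤ Θ ^ 2 * x ^ b := mul_le_mul hθ2 hxa (Real.rpow_nonneg hx0.le _) (by positivity)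
  have h2 : θ ^ 3 * x ^ a₁ ≤ Θ ^ 3 * x ^ b := mul_le_mul hθ3 hxa₁ (Real.rpow_nonneg hx0.le _) (by positivity)
  calc max Cp 0 * E * θ ^ 2 * x₄ * x ^ a + Q * θ ^ 3 * E * x₄ * x ^ a₁
      = (max Cp 0 * E * x₄) * (θ ^ 2 * x ^ a) + (Q * E * x₄) * (θ ^ 3 * x ^ a₁) := by ring
    _ ≤ (max Cp 0 * E * x₄) * (Θ ^ 2 * x ^ b) + (Q * E * x₄) * (Θ ^ 3 * x ^ b) :=
        add_le_add (mul_le_mul_of_nonneg_left h1 (by positivity)) (mul_le_mul_of_nonneg_left h2 (by positivity))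
    _ = (max Cp 0 * Θ ^ 2 + Q * Θ ^ 3) * E * x₄ * x ^ b := by ring

/-! ## §2 `PolymerCauchyAt` from the per-run clauses, the corrected two-run bundle and the minimiser closeness -/

/-- **THE POLYMER SOCKET, DISCHARGED FROM THE CLAUSES** (S-E″, threshold-free): for `1 < L`, `0 < γ ≤ 1`, `0 < b₀`, `0 < p₀`, `0 < a`, `0 < a₁` and
`m > (3+b)/b` with `b = min(a, a₁, 1)`, the per-run clauses `AdmOnSmall`, `UminTrivIsRegMinimiser(ε₀)`, `TrivRegions`, `Regularity68(C68)`, the corrected two-run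
bundle `TwoRunLv D b₀ p₀ C68 a` and the minimiser closeness `MinimiserCauchyAt F γ ε₀ b₀ p₀ a₁` give `PolymerCauchyAt D b₀ p₀ m` — budgets: for `K ≥ K₀(D)`
(the three guards, `eventually_mul_θBal_div_le`) the per-polymer matched estimate of part 1 under one monomial `M₀e^{−κ₁𝓛}L^{−4(k−i)}(L^{−i})^{b}`, else the
size fallback `|𝒫′| + |𝒫| + |c|`; extra finest slice `Σ C⁺e^{−κ₁𝓛}Θ²L^{−4k}` with `c₀ = 0`; summability from part 2 (`M(K+1)rᴷ`, `r = L^{−(b−(3+b)/m)} < 1`).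
[cite: King1986, Thm 3.4 (3.9) p.656 and (3.12)-(3.13) p.657] -/
theorem polymerCauchyAt_of_twoRunLv {b₀ p₀ ε₀ a a₁ C68 : ℝ} {m : ℕ}
    (hL : 1 < F.L) (hγ : 0 < γ) (hγ1 : γ ≤ 1) (hb : 0 < b₀) (hp : 0 < p₀) (ha : 0 < a) (ha₁ : 0 < a₁)
    (hm : (3 + min (min a a₁) 1) / min (min a a₁) 1 < (m : ℝ))
    (hMC : MinimiserCauchyAt F γ ε₀ b₀ p₀ a₁) (hAdm : AdmOnSmall D b₀ p₀) (hUmin : UminTrivIsRegMinimiser D b₀ p₀ ε₀)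
    (hTriv : TrivRegions D) (h68 : Regularity68 D b₀ p₀ C68) (hTR : TwoRunLv D b₀ p₀ C68 a) :
    PolymerCauchyAt D b₀ p₀ m := by
  classical
  obtain ⟨κ₁, ⟨Cts, hTS⟩, ⟨C', hLC⟩, hBV, ⟨CL, α₁, t₀, ht₀, hLip⟩, hLM, ⟨Cp, c, hLv⟩⟩ := hTR
  obtain ⟨Cmc, hMC'⟩ := hMC
  -- the exponent b and the free fraction m
  set b : ℝ := min (min a a₁) 1 with hbdef
  have hb0 : 0 < b := lt_min (lt_min ha ha₁) one_pos
  have hb1 : b ≤ 1 := min_le_right _ _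
  have hba : b ≤ a := (min_le_left _ _).trans (min_le_left _ _)
  have hba₁ : b ≤ a₁ := (min_le_left _ _).trans (min_le_right _ _)
  have hm0r : (0 : ℝ) < m := lt_trans (by positivity) hm
  have hm0 : 0 < m := by exact_mod_cast hm0r
  have hc0 : 0 < b - (3 + b) / m := by
    have : (3 + b) / (m : ℝ) < b := by
      rw [div_lt_iff₀ hm0r]
      have := (div_lt_iff₀ hb0).mp hm
      linarith
    linarith
  have hLr : (1 : ℝ) < (F.L : ℝ) := by exact_mod_cast hL
  have hL0 : (0 : ℝ) < (F.L : ℝ) := by linarith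
  obtain ⟨hr0, hr1⟩ := rpow_neg_lt_one hLr hc0
  -- the uniform bound Θ of the thresholds and the constants
  obtain ⟨Θ, hΘdef⟩ : ∃ Θ : ℝ, Θ = b₀ * ((2 * p₀) ^ p₀ * Real.exp (1 / 2 - p₀)) * Real.sqrt (Real.sqrt γ) := ⟨_, rfl⟩
  have hθΘ : ∀ i, θBal F.L γ b₀ p₀ i ≤ Θ := fun i => by
    rw [hΘdef]; exact T3Thresholds.θBal_le_const_mul_rpow hL.le hγ hγ1 hb.le hp i
  have hθ0 : ∀ i, 0 < θBal F.L γ b₀ p₀ i := T3MinimiserStabilityReduction.θBal_pos hL.le hγ hγ1 hb p₀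
  have hΘ0 : 0 ≤ Θ := (hθ0 0).le.trans (hθΘ 0)
  have hα : 0 < α₁ := hLip.1
  obtain ⟨Q, hQdef⟩ : ∃ Q : ℝ, Q = max CL 0 * (151 * (max C68 0 + 1)) ^ 2 * max Cmc 0 / α₁ := ⟨_, rfl⟩
  have hQ : 0 ≤ Q := by rw [hQdef]; positivity
  obtain ⟨M₀, hM₀def⟩ : ∃ M₀ : ℝ, M₀ = max Cp 0 * Θ ^ 2 + Q * Θ ^ 3 := ⟨_, rfl⟩
  have hM₀ : 0 ≤ M₀ := by rw [hM₀def]; positivity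
  -- the guards hold from some K₀ on
  obtain ⟨K₁, hK₁⟩ := T3Thresholds.eventually_mul_θBal_div_le hL hγ hγ1 hb p₀ hm0 (B := 151 * (max C68 0 + 1)) (by positivity) ht₀
  obtain ⟨K₂, hK₂⟩ := T3Thresholds.eventually_mul_θBal_div_le hL hγ hγ1 hb p₀ hm0 (B := max Cmc 0) (le_max_right _ _) (half_pos hα)
  obtain ⟨K₃, hK₃⟩ := T3Thresholds.eventually_mul_θBal_div_le hL hγ hγ1 hb p₀ hm0 (B := 25 / 4 * (max C68 0 + 1)) (by positivity)
    (half_pos (deltaSU_pos (n := Fin 2)))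
  obtain ⟨K₀, hK₀1, hK₀2, hK₀3⟩ : ∃ K₀ : ℕ, K₁ ≤ K₀ ∧ K₂ ≤ K₀ ∧ K₃ ≤ K₀ :=
    ⟨max K₁ (max K₂ K₃), le_max_left _ _, (le_max_left _ _).trans (le_max_right _ _), (le_max_right _ _).trans (le_max_right _ _)⟩
  -- the budgets (opaque names with defining equations)
  obtain ⟨ηg, hηg⟩ : ∃ ηg : (K j : ℕ) → Set (Site (F.P K) 0) → ℝ, ∀ K j Y, ηg K j Y =
      M₀ * Real.exp (-κ₁ * D.treeLen K (1 + j) Y) * (((F.L : ℝ) ^ (K - K / m - 1 - j))⁻¹) ^ 4 * (((F.L : ℝ) ^ (1 + j))⁻¹) ^ b :=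
    ⟨_, fun _ _ _ => rfl⟩
  obtain ⟨ηf, hηf⟩ : ∃ ηf : (K j : ℕ) → Set (Site (F.P K) 0) → ℝ, ∀ K j Y, ηf K j Y =
      max Cts 0 * Real.exp (-κ₁ * D.treeLen (K + 1) (1 + (j + 1)) (refineSet F K Y)) * Θ ^ 2 *
          (((F.L : ℝ) ^ (K + 1 - K / m - (1 + (j + 1))))⁻¹) ^ 4 +
        max Cts 0 * Real.exp (-κ₁ * D.treeLen K (1 + j) Y) * Θ ^ 2 * (((F.L : ℝ) ^ (K - K / m - (1 + j)))⁻¹) ^ 4 +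
        |c K (K / m) j Y| :=
    ⟨_, fun _ _ _ => rfl⟩
  obtain ⟨δ₀, hδ₀⟩ : ∃ δ₀ : ℕ → ℝ, ∀ K, δ₀ K = ∑ Y ∈ D.Loc (K + 1) (K + 1 - K / m) (D.triv (K + 1) (K + 1 - K / m)) 1,
      max Cts 0 * Real.exp (-κ₁ * D.treeLen (K + 1) 1 Y) * Θ ^ 2 * (((F.L : ℝ) ^ (K - K / m))⁻¹) ^ 4 :=
    ⟨_, fun _ => rfl⟩
  obtain ⟨η, hη⟩ : ∃ η : (K j : ℕ) → Set (Site (F.P K) 0) → ℝ, ∀ K j Y, η K j Y = if K₀ ≤ K then ηg K j Y else ηf K j Y :=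
    ⟨_, fun _ _ _ => rfl⟩
  have hηg0 : ∀ K j Y, 0 ≤ ηg K j Y := fun K j Y => by rw [hηg]; positivity
  have hηf0 : ∀ K j Y, 0 ≤ ηf K j Y := fun K j Y => by rw [hηf]; positivity
  have hη0 : ∀ K j Y, 0 ≤ η K j Y := fun K j Y => by
    rw [hη]
    split_ifs
    · exact hηg0 K j Y
    · exact hηf0 K j Y
  have hδ₀0 : ∀ K, 0 ≤ δ₀ K := fun K => by rw [hδ₀]; exact Finset.sum_nonneg fun Y _ => by positivity
  refine ⟨η, fun K j Y => c K (K / m) j Y, δ₀, fun _ => 0, hη0, hδ₀0, ?_, fun K => ?_, fun K j hj Y hY => ?_⟩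
  · -- summability: the majorant `Mtot·(K+1)·r^K` dominates from `K₀` on
    have hA : 0 ≤ 8 * max Cts 0 * max C' 0 * Θ ^ 2 * (F.L : ℝ) ^ (3 * F.m) := by positivity
    have hB : 0 ≤ 8 * M₀ * max C' 0 * (F.L : ℝ) ^ (3 * F.m) := by positivity
    have hbound : ∀ K, K₀ ≤ K →
        δ₀ K + ∑ j ∈ Finset.range (K - K / m), ∑ Y ∈ D.Loc K (K - K / m) (D.triv K (K - K / m)) (1 + j), η K j Y ≤
          (8 * max Cts 0 * max C' 0 * Θ ^ 2 * (F.L : ℝ) ^ (3 * F.m) + 8 * M₀ * max C' 0 * (F.L : ℝ) ^ (3 * F.m)) * ((K : ℝ) + 1) *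
            ((F.L : ℝ) ^ (-(b - (3 + b) / m))) ^ K := by
      intro K hK
      have hsum : ∑ j ∈ Finset.range (K - K / m), ∑ Y ∈ D.Loc K (K - K / m) (D.triv K (K - K / m)) (1 + j), η K j Y =
          ∑ j ∈ Finset.range (K - K / m), ∑ Y ∈ D.Loc K (K - K / m) (D.triv K (K - K / m)) (1 + j),
            M₀ * Real.exp (-κ₁ * D.treeLen K (1 + j) Y) * (((F.L : ℝ) ^ (K - K / m - 1 - j))⁻¹) ^ 4 * (((F.L : ℝ) ^ (1 + j))⁻¹) ^ b :=
        Finset.sum_congr rfl fun j _ => Finset.sum_congr rfl fun Y _ => by rw [hη, if_pos hK, hηg]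
      rw [hsum, hδ₀]
      have hn : K / m ≤ K := Nat.div_le_self K m
      have hex := extra_budget_le D hLC hBV (C := max Cts 0) (Θ := Θ) (le_max_right _ _) hb1 hn (D.triv (K + 1) (K + 1 - K / m))
      have hma := matched_budget_le D hLC hBV hM₀ hb1 hn (D.triv K (K - K / m))
      have hdec := rpow_free_fraction_le hLr hb0.le hm0 K
      have hkK : ((K - K / m : ℕ) : ℝ) ≤ (K : ℝ) + 1 := by
        have : ((K - K / m : ℕ) : ℝ) ≤ K := by exact_mod_cast Nat.sub_le K (K / m)
        linarith
      have hK1 : (1 : ℝ) ≤ (K : ℝ) + 1 := by have : (0 : ℝ) ≤ K := Nat.cast_nonneg K; linarith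
      have he0 : 0 ≤ (F.L : ℝ) ^ ((3 * (K / m : ℕ) - b * (K - K / m : ℕ) : ℝ)) := Real.rpow_nonneg hL0.le _
      -- abbreviate
      have step1 := add_le_add hex hma
      refine step1.trans ?_
      have hAe : 8 * max Cts 0 * max C' 0 * Θ ^ 2 * (F.L : ℝ) ^ (3 * F.m) * (F.L : ℝ) ^ ((3 * (K / m : ℕ) - b * (K - K / m : ℕ) : ℝ)) ≤
          ((K : ℝ) + 1) * (8 * max Cts 0 * max C' 0 * Θ ^ 2 * (F.L : ℝ) ^ (3 * F.m) * ((F.L : ℝ) ^ (-(b - (3 + b) / m))) ^ K) := by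
        have h1 : 8 * max Cts 0 * max C' 0 * Θ ^ 2 * (F.L : ℝ) ^ (3 * F.m) * (F.L : ℝ) ^ ((3 * (K / m : ℕ) - b * (K - K / m : ℕ) : ℝ)) ≤
            8 * max Cts 0 * max C' 0 * Θ ^ 2 * (F.L : ℝ) ^ (3 * F.m) * ((F.L : ℝ) ^ (-(b - (3 + b) / m))) ^ K :=
          mul_le_mul_of_nonneg_left hdec hA
        exact h1.trans (le_mul_of_one_le_left (mul_nonneg hA (pow_nonneg hr0.le K)) hK1)
      have hBe : ((K - K / m : ℕ) : ℝ) * (8 * M₀ * max C' 0 * (F.L : ℝ) ^ (3 * F.m) * (F.L : ℝ) ^ ((3 * (K / m : ℕ) - b * (K - K / m : ℕ) : ℝ))) ≤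
          ((K : ℝ) + 1) * (8 * M₀ * max C' 0 * (F.L : ℝ) ^ (3 * F.m) * ((F.L : ℝ) ^ (-(b - (3 + b) / m))) ^ K) :=
        mul_le_mul hkK (mul_le_mul_of_nonneg_left hdec hB) (mul_nonneg hB he0) (by linarith)
      refine (add_le_add hAe hBe).trans (le_of_eq ?_)
      ring
    have hnn : ∀ K, 0 ≤ δ₀ K + ∑ j ∈ Finset.range (K - K / m), ∑ Y ∈ D.Loc K (K - K / m) (D.triv K (K - K / m)) (1 + j), η K j Y :=
      fun K => add_nonneg (hδ₀0 K) (Finset.sum_nonneg fun j _ => Finset.sum_nonneg fun Y _ => hη0 K j Y)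
    refine (summable_nat_add_iff K₀).mp ?_
    refine Summable.of_nonneg_of_le (fun K => hnn (K + K₀)) (fun K => hbound (K + K₀) (Nat.le_add_left K₀ K)) ?_
    exact (summable_nat_add_iff K₀).mpr (summable_majorant _ hr0.le hr1)
  · -- the extra finest slice of run K+1: TermSize alone
    refine ae_of_all _ fun V hV _ _ => ?_
    rw [sub_zero, hδ₀]
    have hn : K / m ≤ K := Nat.div_le_self K m
    have hn' : K / m ≤ K + 1 := hn.trans (Nat.le_succ K)
    refine (Finset.abs_sum_le_sum_abs _ _).trans (Finset.sum_le_sum fun Y hY => ?_)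
    have h1 := abs_pterm_umin_triv_le D hAdm hTS hn' V hV (i := 1) le_rfl (by omega) hY
    refine h1.trans ?_
    have hKK : K + 1 - K / m - 1 = K - K / m := by omega
    rw [hKK]
    have hθ2 : θBal F.L γ b₀ p₀ (K / m + 1) ^ 2 ≤ Θ ^ 2 := pow_le_pow_left₀ (hθ0 _).le (hθΘ _) 2
    have hX : 0 ≤ Real.exp (-κ₁ * D.treeLen (K + 1) 1 Y) * (((F.L : ℝ) ^ (K - K / m))⁻¹) ^ 4 := by positivity
    calc Cts * Real.exp (-κ₁ * D.treeLen (K + 1) 1 Y) * θBal F.L γ b₀ p₀ (K / m + 1) ^ 2 * (((F.L : ℝ) ^ (K - K / m))⁻¹) ^ 4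
        = Cts * θBal F.L γ b₀ p₀ (K / m + 1) ^ 2 * (Real.exp (-κ₁ * D.treeLen (K + 1) 1 Y) * (((F.L : ℝ) ^ (K - K / m))⁻¹) ^ 4) := by ring
      _ ≤ max Cts 0 * Θ ^ 2 * (Real.exp (-κ₁ * D.treeLen (K + 1) 1 Y) * (((F.L : ℝ) ^ (K - K / m))⁻¹) ^ 4) := by
          refine mul_le_mul_of_nonneg_right ?_ hX
          calc Cts * θBal F.L γ b₀ p₀ (K / m + 1) ^ 2 ≤ max Cts 0 * θBal F.L γ b₀ p₀ (K / m + 1) ^ 2 :=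
                mul_le_mul_of_nonneg_right (le_max_left _ _) (by positivity)
            _ ≤ max Cts 0 * Θ ^ 2 := mul_le_mul_of_nonneg_left hθ2 (le_max_right _ _)
      _ = max Cts 0 * Real.exp (-κ₁ * D.treeLen (K + 1) 1 Y) * Θ ^ 2 * (((F.L : ℝ) ^ (K - K / m))⁻¹) ^ 4 := by ring
  · -- the matched pairs
    refine ae_of_all _ fun V hV _ _ => ?_
    rw [hη]
    have hn : K / m ≤ K := Nat.div_le_self K m
    have hn' : K / m ≤ K + 1 := hn.trans (Nat.le_succ K)
    by_cases hK : K₀ ≤ K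
    · -- good regime: the per-polymer matched estimate under the guards
      rw [if_pos hK, hηg]
      have hest := abs_matched_sub_le D hL hγ hγ1 hb ha₁.le hAdm hUmin hTriv h68 hLip hLv hMC' hn hj hY V hV
        (hK₁ K (hK₀1.trans hK)) (hK₂ K (hK₀2.trans hK)) (hK₃ K (hK₀3.trans hK))
      refine hest.trans ?_
      have hx0 : 0 < ((F.L : ℝ) ^ (1 + j))⁻¹ := by positivity
      have hx1 : ((F.L : ℝ) ^ (1 + j))⁻¹ ≤ 1 := inv_le_one_of_one_le₀ (one_le_pow₀ hLr.le)
      have hgood := good_bound (Cp := Cp) (Q := Q) (E := Real.exp (-κ₁ * D.treeLen K (1 + j) Y))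
        (x₄ := (((F.L : ℝ) ^ (K - K / m - 1 - j))⁻¹) ^ 4) hQ (hθ0 (K / m)) (hθΘ (K / m)) (Real.exp_nonneg _) (by positivity) hx0 hx1 hba hba₁
      rw [hQdef] at hgood
      rw [hM₀def, hQdef]
      exact hgood
    · -- fallback: the sizes of both terms and of the shift
      rw [if_neg hK, hηf]
      have hbij := hLM K (K / m) hn (1 + j) (by omega) (by omega)
      have hY' : refineSet F K Y ∈ D.Loc (K + 1) (K + 1 - K / m) (D.triv (K + 1) (K + 1 - K / m)) (1 + (j + 1)) := hbij.mapsTo hY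
      have h1 := abs_pterm_umin_triv_le D hAdm hTS hn' V hV (i := 1 + (j + 1)) (by omega) (by omega) hY'
      have h2 := abs_pterm_umin_triv_le D hAdm hTS hn V hV (i := 1 + j) (by omega) (by omega) hY
      have hθ2 : θBal F.L γ b₀ p₀ (K / m + 1) ^ 2 ≤ Θ ^ 2 := pow_le_pow_left₀ (hθ0 _).le (hθΘ _) 2
      -- |x − y − c| ≤ |x| + |y| + |c|
      have htri : ∀ x y z : ℝ, |x - y - z| ≤ |x| + |y| + |z| := fun x y z => by
        calc |x - y - z| ≤ |x - y| + |z| := abs_sub _ _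
          _ ≤ |x| + |y| + |z| := by linarith [abs_sub x y]
      refine (htri _ _ _).trans ?_
      refine add_le_add (add_le_add (h1.trans ?_) (h2.trans ?_)) le_rfl
      · have hX : 0 ≤ Real.exp (-κ₁ * D.treeLen (K + 1) (1 + (j + 1)) (refineSet F K Y)) *
            (((F.L : ℝ) ^ (K + 1 - K / m - (1 + (j + 1))))⁻¹) ^ 4 := by positivity
        calc Cts * Real.exp (-κ₁ * D.treeLen (K + 1) (1 + (j + 1)) (refineSet F K Y)) * θBal F.L γ b₀ p₀ (K / m + 1) ^ 2 *
              (((F.L : ℝ) ^ (K + 1 - K / m - (1 + (j + 1))))⁻¹) ^ 4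
            = Cts * θBal F.L γ b₀ p₀ (K / m + 1) ^ 2 * (Real.exp (-κ₁ * D.treeLen (K + 1) (1 + (j + 1)) (refineSet F K Y)) *
                (((F.L : ℝ) ^ (K + 1 - K / m - (1 + (j + 1))))⁻¹) ^ 4) := by ring
          _ ≤ max Cts 0 * Θ ^ 2 * (Real.exp (-κ₁ * D.treeLen (K + 1) (1 + (j + 1)) (refineSet F K Y)) *
                (((F.L : ℝ) ^ (K + 1 - K / m - (1 + (j + 1))))⁻¹) ^ 4) := by
              refine mul_le_mul_of_nonneg_right ?_ hX
              calc Cts * θBal F.L γ b₀ p₀ (K / m + 1) ^ 2 ≤ max Cts 0 * θBal F.L γ b₀ p₀ (K / m + 1) ^ 2 :=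
                    mul_le_mul_of_nonneg_right (le_max_left _ _) (by positivity)
                _ ≤ max Cts 0 * Θ ^ 2 := mul_le_mul_of_nonneg_left hθ2 (le_max_right _ _)
          _ = _ := by ring
      · have hX : 0 ≤ Real.exp (-κ₁ * D.treeLen K (1 + j) Y) * (((F.L : ℝ) ^ (K - K / m - (1 + j)))⁻¹) ^ 4 := by positivity
        calc Cts * Real.exp (-κ₁ * D.treeLen K (1 + j) Y) * θBal F.L γ b₀ p₀ (K / m + 1) ^ 2 * (((F.L : ℝ) ^ (K - K / m - (1 + j)))⁻¹) ^ 4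
            = Cts * θBal F.L γ b₀ p₀ (K / m + 1) ^ 2 * (Real.exp (-κ₁ * D.treeLen K (1 + j) Y) * (((F.L : ℝ) ^ (K - K / m - (1 + j)))⁻¹) ^ 4) := by
              ring
          _ ≤ max Cts 0 * Θ ^ 2 * (Real.exp (-κ₁ * D.treeLen K (1 + j) Y) * (((F.L : ℝ) ^ (K - K / m - (1 + j)))⁻¹) ^ 4) := by
              refine mul_le_mul_of_nonneg_right ?_ hX
              calc Cts * θBal F.L γ b₀ p₀ (K / m + 1) ^ 2 ≤ max Cts 0 * θBal F.L γ b₀ p₀ (K / m + 1) ^ 2 :=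
                    mul_le_mul_of_nonneg_right (le_max_left _ _) (by positivity)
                _ ≤ max Cts 0 * Θ ^ 2 := mul_le_mul_of_nonneg_left hθ2 (le_max_right _ _)
          _ = _ := by ring

/-! ## §3 `CauchyAtHeights` (the v5d stub's conclusion) — clause-level, threshold-free; and in the registered quantifier shape -/

/-- **S-E″ CLOSED (clause level, threshold-free)**: for `1 < L`, `0 < γ ≤ 1`, `0 < b₀`, `0 < p₀`, `0 < a`, `0 < a₁`, `m > (3+b)/b` (`b = min(a,a₁,1)`):
`MinimiserCauchyAt F γ ε₀ b₀ p₀ a₁`, `PintDecomp D`, `AdmOnSmall D b₀ p₀`, `UminTrivIsRegMinimiser D b₀ p₀ ε₀`, `TrivRegions D`, `Regularity68 D b₀ p₀ C68` and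
`TwoRunLv D b₀ p₀ C68 a` give the cut-off-Cauchy property `CauchyAtHeights D b₀ p₀ m` — `polymerCauchyAt_of_twoRunLv`, then `levelCauchyAt_of_polymerwise`
(p458947, `LocMatched` from the bundle), then `cauchyAtHeights_of_levelwise` (p456396). [cite: King1986, Thm 3.4 (3.9) p.656] -/
theorem cauchyAtHeights_of_twoRunLv {b₀ p₀ ε₀ a a₁ C68 : ℝ} {m : ℕ}
    (hL : 1 < F.L) (hγ : 0 < γ) (hγ1 : γ ≤ 1) (hb : 0 < b₀) (hp : 0 < p₀) (ha : 0 < a) (ha₁ : 0 < a₁)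
    (hm : (3 + min (min a a₁) 1) / min (min a a₁) 1 < (m : ℝ))
    (hMC : MinimiserCauchyAt F γ ε₀ b₀ p₀ a₁) (hdec : PintDecomp D) (hAdm : AdmOnSmall D b₀ p₀) (hUmin : UminTrivIsRegMinimiser D b₀ p₀ ε₀)
    (hTriv : TrivRegions D) (h68 : Regularity68 D b₀ p₀ C68) (hTR : TwoRunLv D b₀ p₀ C68 a) :
    CauchyAtHeights D b₀ p₀ m := by
  have hLM : LocMatched D := by
    obtain ⟨κ₁, -, -, -, -, hLM, -⟩ := hTR
    exact hLM
  exact LogComparisonSocketLevelsAlpha.cauchyAtHeights_of_levelwise D hdec b₀ p₀ m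
    (LogComparisonSocketPolymers.levelCauchyAt_of_polymerwise D b₀ p₀ m hLM
      (polymerCauchyAt_of_twoRunLv D hL hγ hγ1 hb hp ha ha₁ hm hMC hAdm hUmin hTriv h68 hTR))

/-- **THE PROPOSED v5e TEXT OF `stub_levelCauchyOfSchemas`** — the registered v5d quantifier shape VERBATIM with `TwoRun D b₀ p₀ C68 a` replaced by
`TrivRegions D → TwoRunLv D b₀ p₀ C68 a` (the registered text consumes the mis-scaled `PolymerCauchyBgAt` and lacks `TrivRegions`, FINDING-19201-SE2-scaling):
PROVED, with `ε₁ = 1`, `m₀ = ⌈(3+b)/b⌉ + 1`, `γ₁ = 1`; the per-run clauses come from the package `T3AlphaInputsACSchemas.AlphaInputsT3AC D b₀ p₀ ε₀ C68` (v1.1; any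
re-cut of its size bundle, e.g. card C1's `SizesNoE`, leaves this proof unchanged — sizes are not consumed). [cite: King1986, Thm 3.4 (3.9) p.656] -/
theorem levelCauchyOfSchemas_lv :
    ∀ (L : ℕ), Odd L → 1 < L → ∀ (a a₁ : ℝ), 0 < a → 0 < a₁ →
      ∃ ε₁ : ℝ, 0 < ε₁ ∧ ∀ (ε₀ : ℝ), 0 < ε₀ → ε₀ ≤ ε₁ → ∃ m₀ : ℕ, ∀ (m : ℕ), m₀ ≤ m → ∀ (b₀ p₀ : ℝ), 0 < b₀ → 2 < p₀ →
        ∃ γ₁ : ℝ, 0 < γ₁ ∧ ∀ (F : T3Family) (γ : ℝ), F.L = L → 0 < γ → γ ≤ γ₁ →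
          MinimiserCauchyAt F γ ε₀ b₀ p₀ a₁ →
            ∀ (D : AlphaDataT3 F γ) (C68 : ℝ),
              Literature.MathematicalPhysics.QuantumFieldTheory.Balaban1983to89.T3AlphaInputsACSchemas.AlphaInputsT3AC D b₀ p₀ ε₀ C68 →
                TrivRegions D → TwoRunLv D b₀ p₀ C68 a → CauchyAtHeights D b₀ p₀ m := by
  intro L _ hL a a₁ ha ha₁
  refine ⟨1, one_pos, fun ε₀ _ _ => ?_⟩
  refine ⟨Nat.ceil ((3 + min (min a a₁) 1) / min (min a a₁) 1) + 1, fun m hm b₀ p₀ hb hp => ?_⟩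
  refine ⟨1, one_pos, fun F γ hF hγ hγ1 hMC D C68 hPkg hTriv hTR => ?_⟩
  have hm' : (3 + min (min a a₁) 1) / min (min a a₁) 1 < (m : ℝ) := by
    have h1 := Nat.le_ceil ((3 + min (min a a₁) 1) / min (min a a₁) 1)
    have h2 : ((Nat.ceil ((3 + min (min a a₁) 1) / min (min a a₁) 1) + 1 : ℕ) : ℝ) ≤ m := by exact_mod_cast hm
    push_cast at h2
    linarith
  have hL' : 1 < F.L := by rw [hF]; exact hL
  exact cauchyAtHeights_of_twoRunLv D hL' hγ hγ1 hb (by linarith) ha ha₁ hm' hMC hPkg.1.1 hPkg.admOnSmall hPkg.uminTrivIsRegMinimiser hTriv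
    hPkg.regularity68 hTR

end Summit.QuantumFields.YangMills.Theorems.LogComparisonLevelCauchy

end
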